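import Mathlib.FieldTheory.IntermediateField.Adjoin.Basic
import Literature.FieldTheory.Regular.RacPurelyTranscendental
import HarnessLib

/-!
# Relative algebraic closedness along a tower of division points

Let `k ≤ K` be intermediate fields of `Ω/F₀` (`Ω` of characteristic `0`) with `k` relatively
algebraically closed in `K`, and let `u₀, u₁, u₂, … : Fin s → Ω` be finite families with
`u_{m+1,j}^{m+1} = u_{m,j}` (so `u_m` consists of `m!`-th roots of `u₀`, a "tower of division
points", as for `u_{m,j} = exp (xⱼ/m!)` in an exponential field) such that every level `u_m` is
algebraically independent over `K`. Then `k(u_m : m)` is relatively algebraically closed in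
`K(u_m : m)` (`Literature.FieldTheory.Regular.mem_adjoin_iUnion_of_isAlgebraic`): both fields are
increasing unions of the purely transcendental extensions `k(u_m) ⊆ K(u_m)`, to which the case of
a single algebraically independent family
(`Literature.FieldTheory.Regular.mem_adjoin_of_isAlgebraic_of_algebraicIndependent`, Lang,
*Algebra* VIII §4) applies. Used for the Γ-fields of Bays–Kirby (the full Γ-field generated by a
tuple is such a tower over its level-`0` field).

## References

* S. Lang, *Algebra*, 3rd ed., GTM 211, Springer 2002, VIII §4.
-/

noncomputable section

open Set

namespace Literature.FieldTheory.Regular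

variable {F₀ Ω : Type*} [Field F₀] [Field Ω] [Algebra F₀ Ω]

/-- Along a tower `u_{m+1,j}^{m+1} = u_{m,j}`, the fields `E(u_m)` increase with `m`. [folklore] -/
theorem adjoin_range_mono_of_pow_succ_eq (E : IntermediateField F₀ Ω) {s : ℕ} (u : ℕ → Fin s → Ω)
    (hu : ∀ m j, u (m + 1) j ^ (m + 1) = u m j) :
    Monotone fun m => IntermediateField.adjoin E (range (u m)) := by
  refine monotone_nat_of_le_succ fun m => ?_
  refine IntermediateField.adjoin_le_iff.2 ?_
  rintro _ ⟨j, rfl⟩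
  rw [← hu m j]
  exact pow_mem (IntermediateField.subset_adjoin _ _ (mem_range_self j)) _

/-- A finite subset of `⋃ₘ range u_m` lies in some `E(u_M)`. [folklore] -/
theorem exists_finset_subset_adjoin_range (E : IntermediateField F₀ Ω) {s : ℕ} (u : ℕ → Fin s → Ω)
    (hu : ∀ m j, u (m + 1) j ^ (m + 1) = u m j) (T : Finset Ω)
    (hT : (↑T : Set Ω) ⊆ ⋃ m, range (u m)) :
    ∃ M, ∀ M', M ≤ M' → (↑T : Set Ω) ⊆ (IntermediateField.adjoin E (range (u M')) : Set Ω) := by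
  classical
  induction T using Finset.induction_on with
  | empty => exact ⟨0, fun _ _ => by simp⟩
  | insert t T ht ih =>
    rw [Finset.coe_insert] at hT
    obtain ⟨M₀, hM₀⟩ := ih ((subset_insert _ _).trans hT)
    obtain ⟨m₁, hm₁⟩ := mem_iUnion.1 (hT (mem_insert _ _))
    refine ⟨max M₀ m₁, fun M' hM' => ?_⟩
    rw [Finset.coe_insert]
    refine insert_subset ?_ (hM₀ M' ((le_max_left _ _).trans hM'))
    exact adjoin_range_mono_of_pow_succ_eq E u hu ((le_max_right _ _).trans hM')
      (IntermediateField.subset_adjoin _ _ hm₁)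

/-- Every element of `E(u_m : m)` lies in some `E(u_M)` (and in all later ones). [folklore] -/
theorem exists_mem_adjoin_range_of_mem_adjoin_iUnion (E : IntermediateField F₀ Ω) {s : ℕ}
    (u : ℕ → Fin s → Ω) (hu : ∀ m j, u (m + 1) j ^ (m + 1) = u m j) {z : Ω}
    (hz : z ∈ IntermediateField.adjoin E (⋃ m, range (u m))) :
    ∃ M, ∀ M', M ≤ M' → z ∈ IntermediateField.adjoin E (range (u M')) := by
  obtain ⟨T, hT, hzT⟩ := IntermediateField.exists_finset_of_mem_adjoin hz
  obtain ⟨M, hM⟩ := exists_finset_subset_adjoin_range E u hu T hT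
  refine ⟨M, fun M' hM' => ?_⟩
  exact (IntermediateField.adjoin_le_iff.2 (hM M' hM')) hzT

/-- `E(u_M) ≤ E(u_m : m)`. [folklore] -/
theorem adjoin_range_le_adjoin_iUnion (E : IntermediateField F₀ Ω) {s : ℕ} (u : ℕ → Fin s → Ω)
    (M : ℕ) : IntermediateField.adjoin E (range (u M)) ≤ IntermediateField.adjoin E (⋃ m, range (u m)) :=
  IntermediateField.adjoin.mono _ _ _ (subset_iUnion (fun m => range (u m)) M)

/-- **Relative algebraic closedness along a tower of division points.** Let `k ≤ K` be
intermediate fields of `Ω/F₀` (characteristic `0`) with `k` relatively algebraically closed in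
`K`, and `u : ℕ → Fin s → Ω` a tower (`u_{m+1,j}^{m+1} = u_{m,j}`) all of whose levels are
algebraically independent over `K`. Then every element of `K(u_m : m)` algebraic over
`k(u_m : m)` lies in `k(u_m : m)`. [cite: Lang2002, VIII §4] -/
theorem mem_adjoin_iUnion_of_isAlgebraic [CharZero Ω] {k K : IntermediateField F₀ Ω} (hkK : k ≤ K)
    (hrac : ∀ z : Ω, z ∈ K → IsAlgebraic k z → z ∈ k)
    {s : ℕ} (u : ℕ → Fin s → Ω) (hu : ∀ m j, u (m + 1) j ^ (m + 1) = u m j)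
    (hind : ∀ m, AlgebraicIndependent K (u m))
    {z : Ω} (hz : z ∈ IntermediateField.adjoin K (⋃ m, range (u m)))
    (halg : IsAlgebraic (IntermediateField.adjoin k (⋃ m, range (u m))) z) :
    z ∈ IntermediateField.adjoin k (⋃ m, range (u m)) := by
  classical
  -- `z ∈ K(u_M)` for large `M`
  obtain ⟨M₁, hM₁⟩ := exists_mem_adjoin_range_of_mem_adjoin_iUnion K u hu hz
  -- the coefficients of an algebraic relation lie in `k(u_M)` for large `M`
  obtain ⟨p, hp0, hpz⟩ := halg
  have hcoef : ∀ i, ∃ M, ∀ M', M ≤ M' →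
      ((p.coeff i : IntermediateField.adjoin k (⋃ m, range (u m))) : Ω) ∈
        IntermediateField.adjoin k (range (u M')) := fun i =>
    exists_mem_adjoin_range_of_mem_adjoin_iUnion k u hu (p.coeff i).2
  choose Mc hMc using hcoef
  obtain ⟨M, hM1, hM2⟩ : ∃ M, M₁ ≤ M ∧ ∀ i ∈ p.support, Mc i ≤ M :=
    ⟨max M₁ (p.support.sup Mc), le_max_left _ _, fun i hi => (Finset.le_sup hi).trans (le_max_right _ _)⟩
  have hkMle : IntermediateField.adjoin k (range (u M)) ≤
      IntermediateField.adjoin k (⋃ m, range (u m)) := adjoin_range_le_adjoin_iUnion k u _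
  -- lift `p` to `k(u_M)`
  let ι : IntermediateField.adjoin k (range (u M)) →+* IntermediateField.adjoin k (⋃ m, range (u m)) :=
    (IntermediateField.inclusion hkMle : _ →ₐ[k] _)
  have hι : ∀ x, ((ι x : IntermediateField.adjoin k (⋃ m, range (u m))) : Ω) = x := fun x =>
    IntermediateField.coe_inclusion hkMle x
  have hlift : p ∈ Polynomial.lifts ι := by
    rw [Polynomial.lifts_iff_coeff_lifts]
    intro i
    by_cases hi : i ∈ p.support
    · have hmem : ((p.coeff i : IntermediateField.adjoin k (⋃ m, range (u m))) : Ω) ∈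
          IntermediateField.adjoin k (range (u M)) := hMc i _ (hM2 i hi)
      exact ⟨⟨_, hmem⟩, Subtype.ext (hι ⟨_, hmem⟩)⟩
    · rw [Polynomial.notMem_support_iff.1 hi]
      exact ⟨0, map_zero ι⟩
  obtain ⟨q, hq⟩ := (Polynomial.mem_lifts _).1 hlift
  have hq0 : q ≠ 0 := by
    rintro rfl
    rw [Polynomial.map_zero] at hq
    exact hp0 hq.symm
  have halgM : IsAlgebraic (IntermediateField.adjoin k (range (u M))) z := by
    refine ⟨q, hq0, ?_⟩
    have h1 : Polynomial.aeval z p =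
        Polynomial.eval₂ ((algebraMap (IntermediateField.adjoin k (⋃ m, range (u m))) Ω).comp ι) z q := by
      rw [← hq, Polynomial.aeval_def, Polynomial.eval₂_map]
    have h2 : (algebraMap (IntermediateField.adjoin k (⋃ m, range (u m))) Ω).comp ι =
        algebraMap (IntermediateField.adjoin k (range (u M))) Ω := by
      ext x; exact hι x
    rw [Polynomial.aeval_def, ← h2, ← h1]
    exact hpz
  -- apply the purely transcendental case at level `M`
  have hzM : z ∈ IntermediateField.adjoin K (range (u M)) := hM₁ _ hM1
  exact adjoin_range_le_adjoin_iUnion k u _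
    (mem_adjoin_of_isAlgebraic_of_algebraicIndependent hkK hrac (u M) (hind M) hzM halgM)

end Literature.FieldTheory.Regular
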